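import Summits.AtomisticToContinuum.Crystallization.Theorems.ChartedZeroExcessLayeredLatticeLiouvilleTL

/-!
# Zero-excess layered lattice Liouville — part TM (lens-2 g37 addendum B, layer 3 beneath (Υ) of part TL): the lateral untwist
(Υ) `LateralUntwistP` splits into its RIGIDITY half (Υc) «UntwistCollarP» (after one global re-gauge of the bond isomorphism, all but
`C_c·κ·#win` window sites are KEPT: every window site within range `4` is good and the bond isomorphism and the registering map have EQUAL
difference vectors there) and its BOOKKEEPING half (Υb) «UntwistBookkeepingP» (a layer-compatible bijective bond isomorphism with few non-kept
sites registers the window at level `(1 + 144·C_c)·κ`: kept sites keep the profile `τ` — the environment clause moves with the in-plane lattice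
translation `Φ' y − Ψ y` (`envClose_of_sameLayer`), the gradient clause is literally that of `Ψ` — and non-kept sites take the trivial profile `12`
of tear-freeness (B4); the position clause holds at a free scale).  Glue (Υ) ⟸ (Υc) ∧ (Υb) PROVED (`lateralUntwistP_of_collar_book`,
`C_U := 1 + 144·C_c`); columns `_16XH15` / `_16XH15W` (:= `_16XH14` / `_16XH14W` of part TL with `hGu := lateralUntwistP_of_collar_book hUc hUb`).
ERRATUM to part TL (docstring of `LateralUntwistP`, why-it-might-fail): the «John-type `L^∞` rigidity (lattice-rotation oscillation `≤ C·θ` on balls)»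
named there is FALSE uniformly in the ball radius for merely clean configurations — the log-spiral `x ↦ Rot_{e₃}(ε·log(|x_h|/ρ₁))·x` has Cauchy–Green
tensor within `2ε + ε²` of the identity and unbounded rotation (small uniform strain gives rotations small in BMO, F. John 1961, not in `L^∞`); the
rigidity (Υ) needs is the VOLUME statement of (Υc): a good component whose re-gauged class is a `120°` point symmetry is SACRIFICED and paid by its
collar of bad sites, via Friesecke–James–Müller `L²` rigidity on balls for the piecewise-affine interpolation on the fcc/hcp tetra–octa tessellation
(collar `≥ pocket/(4·C_FJM·θ²)`).  Memo `ADDENDUM-g37-rigidity.md`.  0 EQUIV; placeholder-free; no type-class declarations, custom syntax or option pragmas.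
-/

noncomputable section

open scoped BigOperators InnerProductSpace RealInnerProductSpace
open MeasureTheory Set Metric Filter Topology
open Summit.AtomisticToContinuum.Crystallization.Theorems.ChartedPlanarOrderRigidityDoor
  (E3 IsClean IsNash IsCharted IsEStarGSC VisibleGap PertRegime atomsIn siteEnergy eStar BindingSurface)
open Summit.AtomisticToContinuum.Crystallization.Theorems.ChartedPlanarOrderDensityDichotomy (μS IsSep nK nK_nonneg excess)
open Summit.AtomisticToContinuum.Crystallization.Theorems.ChartedPlanarOrderMesoCut (IsDoorSet NearHom LayeredHom layerOf EnvClose)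
open Summit.AtomisticToContinuum.Crystallization.Theorems.ChartedPlanarOrderDoorLayered
  (TwoPeriodic DoorPeriodic PeriodicBulkGapDoor NearHomL2BD Layered atomsIn_subset)
open Summit.AtomisticToContinuum.Crystallization.Theorems.ChartedPlanarOrderDoorLayeredOsc (IsTwoShellAffineGood DoorPeriodicOsc)
open Summit.AtomisticToContinuum.Crystallization.Theorems.ChartedPlanarOrderCleanScaleP
  (IsCleanP IsDoorSetP DoorPeriodicP isDoorSetP_one_iff isCleanP_one_iff isCleanP_μS_iff)
open Literature.MathematicalPhysics.StatisticalMechanics (lennardJones IsHaggSeq triangularVec₁ triangularVec₂)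
open Literature.Geometry.DiscreteGeometry (IsTwoShellGoodSet)

namespace Summit.AtomisticToContinuum.Crystallization.Theorems.ChartedZeroExcessLayeredLatticeLiouville

/-! ### XIV.1  Kept sites -/

/-- **kept site** of the window `Q` for the pair (bond isomorphism `Φ`, registering map `Ψ` with profile `τ`): every window site within range `4`
of `y` (so `y` itself when `y ∈ Q`) is good (`τ < 1/8`) and carries the SAME difference vector under `Φ` and under `Ψ`.  On a kept site the
registration clauses of `Ψ` transfer to `Φ` verbatim (the environment clause through the in-plane lattice translation `Φ y − Ψ y`, which is
in-plane by layer-compatibility). [this file, g37] -/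
def KeptSite (Q : Set E3) (Φ Ψ : E3 → E3) (τ : E3 → ℝ) (y : E3) : Prop :=
  ∀ p ∈ Q, dist p y ≤ 4 → τ p < 1 / 8 ∧ Φ p - Φ y = Ψ p - Ψ y

/-- a kept window site is good. [this file, g37] -/
theorem KeptSite.good {Q : Set E3} {Φ Ψ : E3 → E3} {τ : E3 → ℝ} {y : E3} (h : KeptSite Q Φ Ψ τ y) (hy : y ∈ Q) : τ y < 1 / 8 :=
  (h y hy (by simp)).1

/-! ### XIV.2  The two pieces beneath (Υ) -/

/-- ★★ **(Υc) «UntwistCollarP aHi Λ θ s»** [piece] — the RIGIDITY half of (Υ).  Binders of (Υ) verbatim; conclusion: a layer-compatible bijective bond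
isomorphism `Φ' : S → LayeredHom L w` (intended `Φ' := σ⁻¹ ∘ Φ`, `σ` the global symmetry of the chart — an element of `C_{3v}` about a site axis
composed with a lattice translation — that makes the MAJORITY re-gauged class of the good components the identity) whose NON-KEPT window sites number
at most `C_c·κ·#win`.  Non-kept sites are: bad sites (`≤ 64·κ·#win`, Chebyshev), good sites within range `5` of a bad one (`≤ 400×` that), and the good
components whose class is a `120°` point symmetry of the chart (a PHYSICAL rotation of `S` through a bad collar) — the COLLAR LEMMA bounds their total
by `4·5³·C_FJM·(c₁θ + c₂/8)²·#bad`: interpolate `Φ'⁻¹` piecewise-affinely on the tetra–octa tessellation of the hollow-stacked chart (fcc/hcp cells are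
rigid convex polyhedra), apply Friesecke–James–Müller `L²` rigidity on balls (`⨍_B |∇v − R_B|² ≤ C_FJM·⨍_B dist²(∇v, SO(3)) ≤ C_FJM·(c₁θ)²`), note that
two classes `√3` apart cannot both occupy a fraction `> (4/3)·C_FJM·(c₁θ)²` of one ball, so the ball of radius twice the distance from a pocket site to
the majority class is all but `O(C_FJM θ²)` INTERMEDIATE, and intermediate sites are bad (a good site is within `c₁θ + c₂τ < 1/4` of a class by
`EnvClose` at range 4); Vitali.  Translation classes cost nothing here (each kept site needs only its own range-4 neighbourhood matched; two good
components with different in-plane translation holonomy within range 4 of each other are separated by a bad site within range 5).  Finite sub-facts: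
(F-hollow) an equilibrium chart (`IsClean ∧ IsNash` of `LayeredHom L w`) is EXACTLY hollow-stacked, so `C_{3v}` about a site axis acts on it; letter-
flipping classes (`60°`, `180°`, B↔C mirrors) are excluded by layer-compatibility on two consecutive good layers (`2·pos = c` in `ℤ₃` forces equal
consecutive positions).  Why it might fail: (1) the constant `C_FJM·θ²` at the column's `θ = 1/50` (θ is produced by (W)/(A1) from cleanliness `1/16`,
not free) — needs the actual FJM constant of a ball for the tetra–octa interpolation (a finite-element singular value) or a smaller θ; (2) a rotated cap
at `∂B(0,R)` whose collar lies outside the registered window (answer: dislocation-free twist/tilt walls have laterally unbounded strain, so collars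
surround pockets transversally at every scale and the first collar shell inside `B(0,R)` already has volume `≥ c·|pocket ∩ B(0,R)|` — to be made
quantitative); (3) (F-hollow) if not already in the tree.  NOT implied by (Υ) (a specific construction: FILLER on the stronger side isolating the rigidity
step, as (KG) in lens-4's node).  RIGIDITY (FJM `L²`, discrete) + COUNTING · TRUE-type · ATTACKABLE · M.  Sources: [kruzik2019 p.55 Thm 1.1.12],
[FrieseckeJamesMueller2002 Thm 3.1], [arXiv:1501.07505 §3, Thm 3.1 + cell-rigidity lemmas (fcc, hcp)], [arXiv:2004.02368 p.6, p.14 Rem. 5.5(3) (BMO form;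
F. John 1961, cite-only acq-05245)], [this tree: `IsRegistered`, `EnvClose`, `layerOf`, `IsBondIso`, `fccTwoShellPattern`, `hcpTwoShellPattern`].
[this file, g37] -/
def UntwistCollarP (aHi Λ θ s : ℝ) : Prop :=
  ∀ δ : ℝ, 0 < δ → ∀ a : ℝ, 0 < a → ∃ Cc : ℝ, 0 < Cc ∧ ∃ κ₁ : ℝ, 0 < κ₁ ∧ ∃ R₁ : ℝ, 0 < R₁ ∧
    ∀ S : Set E3, IsDoorSetP aHi δ S → (∀ q ∈ S, IsTwoShellAffineGood θ S q) →
      ∀ κ : ℝ, 0 < κ → κ ≤ κ₁ → ∀ R : ℝ, R₁ ≤ R →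
        ∀ (L : E3 ≃L[ℝ] E3) (w : ℤ → E3) (Ψ : E3 → E3) (ρ : ℝ) (τ : E3 → ℝ) (Φ : E3 → E3), IsEquilChart a s Λ L w →
          IsRegistered κ 4 ρ S (atomsIn (μS S) 0 R) (LayeredHom (L : E3 →L[ℝ] E3) w) Ψ τ →
            Set.BijOn Φ S (LayeredHom (L : E3 →L[ℝ] E3) w) → IsBondIso S Φ →
              (∀ x ∈ atomsIn (μS S) 0 R, τ x < 1 / 8 → ∃ m : ℤ, Ψ x ∈ layerOf (L : E3 →L[ℝ] E3) w m ∧ Φ x ∈ layerOf (L : E3 →L[ℝ] E3) w m) →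
                ∃ Φ' : E3 → E3, Set.BijOn Φ' S (LayeredHom (L : E3 →L[ℝ] E3) w) ∧ IsBondIso S Φ' ∧
                  (∀ x ∈ atomsIn (μS S) 0 R, τ x < 1 / 8 →
                    ∃ m : ℤ, Ψ x ∈ layerOf (L : E3 →L[ℝ] E3) w m ∧ Φ' x ∈ layerOf (L : E3 →L[ℝ] E3) w m) ∧
                  nK (atomsIn (μS S) 0 R ∩ {y | ¬ KeptSite (atomsIn (μS S) 0 R) Φ' Ψ τ y}) ≤ Cc * κ * nK (atomsIn (μS S) 0 R)

/-- ★ **(Υb) «UntwistBookkeepingP aHi Λ s»** [piece] — the BOOKKEEPING half of (Υ): for a door set `S`, an equilibrium chart, a registering map `Ψ`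
(level `κ`, profile `τ`) and a layer-compatible bijective bond isomorphism `Φ'` whose non-kept window sites number `≤ C_c·κ·#win`, the map `Φ'`
registers the window at level `(1 + 144·C_c)·κ` at some position scale with the profile `τ₁ := τ` on kept sites and `τ₁ := 12` elsewhere:
kept ⇒ `Φ' y − Ψ y` is an in-plane lattice translation of the chart (both lie in one layer: `exists_inplane_of_layerOf`), so the environment clause
of `Ψ` at `y` is that of `Φ'` (`envClose_of_sameLayer`) and the range-4 gradient clause of `Φ'` at `y` IS that of `Ψ` (equal difference vectors);
non-kept ⇒ `EnvClose 12 4` holds for any `y ∈ S`, `Φ' y ∈ H` (take `q := Φ' y`, `p := y`) and the gradient clause with `12 = 4 + 8` by tear-freeness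
(B4) (`BondIsoTearFreeP`, proved at `aHi = 1`: `bondIsoTearFreeP_one`); `∑ τ₁² ≤ ∑ τ² + 144·C_c·κ·#win`; injectivity and `MapsTo` from `BijOn`; the
position clause `∑ ‖x − Φ' x‖² ≤ κ'·ρ₁²·#win` at the free scale `ρ₁` (finite window).  Why it might fail: only through tear-freeness at `aHi > 1`
(the column uses `aHi = 1`).  ELEMENTARY ACCOUNTING · TRUE-type · S.  Sources: [this tree: `IsRegistered`, `EnvClose`, `envClose_of_sameLayer`,
`exists_inplane_of_layerOf`, `BondIsoTearFreeP`, `bondIsoTearFreeP_one`, `nK`]. [this file, g37] -/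
def UntwistBookkeepingP (aHi Λ s : ℝ) : Prop :=
  ∀ δ : ℝ, 0 < δ → ∀ a : ℝ, 0 < a → ∀ Cc : ℝ, 0 < Cc →
    ∀ S : Set E3, IsDoorSetP aHi δ S → ∀ κ : ℝ, 0 < κ → ∀ R : ℝ, 0 < R →
      ∀ (L : E3 ≃L[ℝ] E3) (w : ℤ → E3) (Ψ : E3 → E3) (ρ : ℝ) (τ : E3 → ℝ) (Φ' : E3 → E3), IsEquilChart a s Λ L w →
        IsRegistered κ 4 ρ S (atomsIn (μS S) 0 R) (LayeredHom (L : E3 →L[ℝ] E3) w) Ψ τ →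
          Set.BijOn Φ' S (LayeredHom (L : E3 →L[ℝ] E3) w) → IsBondIso S Φ' →
            (∀ x ∈ atomsIn (μS S) 0 R, τ x < 1 / 8 → ∃ m : ℤ, Ψ x ∈ layerOf (L : E3 →L[ℝ] E3) w m ∧ Φ' x ∈ layerOf (L : E3 →L[ℝ] E3) w m) →
              nK (atomsIn (μS S) 0 R ∩ {y | ¬ KeptSite (atomsIn (μS S) 0 R) Φ' Ψ τ y}) ≤ Cc * κ * nK (atomsIn (μS S) 0 R) →
                ∃ (ρ₁ : ℝ) (τ₁ : E3 → ℝ), IsRegistered ((1 + 144 * Cc) * κ) 4 ρ₁ S (atomsIn (μS S) 0 R) (LayeredHom (L : E3 →L[ℝ] E3) w) Φ' τ₁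

/-! ### XIV.3  Glue and columns (PROVED) -/

/-- ★★★ **(Υ) ⟸ (Υc) ∧ (Υb) (PROVED)** — re-gauge and sacrifice, then book-keep; `C_U := 1 + 144·C_c`. [this file, g37] -/
theorem lateralUntwistP_of_collar_book {aHi Λ θ s : ℝ} (hc : UntwistCollarP aHi Λ θ s) (hb : UntwistBookkeepingP aHi Λ s) :
    LateralUntwistP aHi Λ θ s := by
  intro δ hδ a ha
  obtain ⟨Cc, hCc, κ₁, hκ₁, R₁, hR₁, H₁⟩ := hc δ hδ a ha
  refine ⟨1 + 144 * Cc, le_add_of_nonneg_right (by positivity), κ₁, hκ₁, R₁, hR₁, ?_⟩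
  intro S hS hgood κ hκ hκle R hR L w Ψ ρ τ Φ hE hreg hbij hiso hlay
  obtain ⟨Φ', hb', hi', hlay', hfew⟩ := H₁ S hS hgood κ hκ hκle R hR L w Ψ ρ τ Φ hE hreg hbij hiso hlay
  obtain ⟨ρ₁, τ₁, hr₁⟩ := hb δ hδ a ha Cc hCc S hS κ hκ R (hR₁.trans_le hR) L w Ψ ρ τ Φ' hE hreg hb' hi' hlay' hfew
  exact ⟨Φ', ρ₁, τ₁, hb', hi', hr₁⟩

/-- ★ **(G♭) ⟸ (Λ♭) ∧ (Υc) ∧ (Υb) (PROVED)**: through `gradPinningThinP_of_laundering_untwist`. [this file, g37] -/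
theorem gradPinningThinP_of_laundering_collar_book {aHi Λ θ s : ℝ} (hl : ThinLaunderingP aHi Λ θ s) (hc : UntwistCollarP aHi Λ θ s)
    (hb : UntwistBookkeepingP aHi Λ s) : GradPinningThinP aHi Λ θ s :=
  gradPinningThinP_of_laundering_untwist hl (lateralUntwistP_of_collar_book hc hb)

/-- ★★★ **COLUMN `_16XH15`** — `_16XH14` of part TL with (Υ) discharged by (Υc) ∧ (Υb) (21 leaves): `LatticeLiouvilleCert → LayeredLiouvilleCert →
R_G → X → Z_E → P → T → U♮ → B1 → G♯ → Λ♭ → Υc → Υb → A0♯⁺ → FF → E → A⁰ → D⁰ → C♭ → R_W → PeriodicBulkGapDoor 2 → VisibleGap (1/50) ∧ PertRegime (1/50)`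
(all at `(aHi; Λ, θ, s) = (1; 2, 1/16, 1/50)`).  Open leaves on the (A0)-line: (B1), (G♯), (Λ♭), (Υc) [rigidity, M], (Υb) [bookkeeping, S].
[this file, g37] -/
theorem gap_and_pert_1_50_of_certs_16XH15 (hL : LatticeLiouvilleCert) (hL' : LayeredLiouvilleCert)
    (hR : OscRigidityL2BDPG 1 2 (1 / 16) (1 / 16)) (hX : ExcessFlatnessControlP 1 2 (1 / 16) (1 / 16))
    (hE : ExcessChartLocalisationP 1 2 (1 / 16) (1 / 50)) (hP : RegistrationP 1 2 (1 / 16) (1 / 50))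
    (hT : TailDominationCert) (hU : UniformTameStability (1 / 50) 2)
    (h1 : WordTransplantP 1 2 (1 / 16) (1 / 50)) (hGT : GradPinningThickP 1 2 (1 / 16) (1 / 50))
    (hGl : ThinLaunderingP 1 2 (1 / 16) (1 / 50)) (hUc : UntwistCollarP 1 2 (1 / 16) (1 / 50)) (hUb : UntwistBookkeepingP 1 2 (1 / 50))
    (hl : BondIsoLevelsP 1 2 (1 / 16) (1 / 50))
    (hF : TailForceSlavingP 1 2 (1 / 16) (1 / 50))
    (hE' : LipDualLinearisationP 1 2 (1 / 16) (1 / 50)) (hA : L2HarmonicApproxP 1 2 (1 / 16) (1 / 50))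
    (hD : PositionDecayPL 1 2 (1 / 16) (1 / 50)) (hC : PositionCaccioppoliPG 1 2 (1 / 16) (1 / 50))
    (hW : WildFractionPG 1 2 (1 / 16) (1 / 50)) (hG : PeriodicBulkGapDoor 2) : VisibleGap (1 / 50) ∧ PertRegime (1 / 50) :=
  gap_and_pert_1_50_of_certs_16XH14 hL hL' hR hX hE hP hT hU h1 hGT hGl (lateralUntwistP_of_collar_book hUc hUb) hl hF hE' hA hD hC hW hG

/-- ★ **COLUMN `_16XH15W`** — the same with (A1) «WildReRegistrationPG» in place of (R_W). [this file, g37] -/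
theorem gap_and_pert_1_50_of_certs_16XH15W (hL : LatticeLiouvilleCert) (hL' : LayeredLiouvilleCert)
    (hR : OscRigidityL2BDPG 1 2 (1 / 16) (1 / 16)) (hX : ExcessFlatnessControlP 1 2 (1 / 16) (1 / 16))
    (hE : ExcessChartLocalisationP 1 2 (1 / 16) (1 / 50)) (hP : RegistrationP 1 2 (1 / 16) (1 / 50))
    (hT : TailDominationCert) (hU : UniformTameStability (1 / 50) 2)
    (h1 : WordTransplantP 1 2 (1 / 16) (1 / 50)) (hGT : GradPinningThickP 1 2 (1 / 16) (1 / 50))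
    (hGl : ThinLaunderingP 1 2 (1 / 16) (1 / 50)) (hUc : UntwistCollarP 1 2 (1 / 16) (1 / 50)) (hUb : UntwistBookkeepingP 1 2 (1 / 50))
    (hl : BondIsoLevelsP 1 2 (1 / 16) (1 / 50))
    (hF : TailForceSlavingP 1 2 (1 / 16) (1 / 50))
    (hE' : LipDualLinearisationP 1 2 (1 / 16) (1 / 50)) (hA : L2HarmonicApproxP 1 2 (1 / 16) (1 / 50))
    (hD : PositionDecayPL 1 2 (1 / 16) (1 / 50)) (hC : PositionCaccioppoliPG 1 2 (1 / 16) (1 / 50))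
    (hw : WildReRegistrationPG 1 2 (1 / 16) (1 / 50)) (hG : PeriodicBulkGapDoor 2) : VisibleGap (1 / 50) ∧ PertRegime (1 / 50) :=
  gap_and_pert_1_50_of_certs_16XH14W hL hL' hR hX hE hP hT hU h1 hGT hGl (lateralUntwistP_of_collar_book hUc hUb) hl hF hE' hA hD hC hw hG

end Summit.AtomisticToContinuum.Crystallization.Theorems.ChartedZeroExcessLayeredLatticeLiouville

end
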